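import Summits.CriticalPhenomena.CardyFormulaZ2.Theorems.CardySelfRefinementLagHandOffHalfPlaneTwoArmUndockedLocality
import HarnessLib

/-!
# Tools for the multiscale sum of the undocked half-plane two-arm bound

Support file for the registered stub `stub_noTouch_undockedThreeArm` of crux
stmt-CriticalPhenomena-10268 (line `hitting-tournament`), towards the undocked half-plane two-arm
bound (X) for critical bond percolation on `ℤ²`.  Two tools of the multiscale summation
(H. Kesten's first good scale; here: first DOCKING scale):

* `real_le_sum_firstFail` — the abstract first-docking-scale union bound for bond percolation on
  `ℤ²` at `1/2`: if a.e. `ω ∈ E` lies in `D_j ∪ B_j` for every `j < J`, the `B_j` being determined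
  by pairwise disjoint edge sets and `D_j` by an edge set disjoint from those of the `B_i`, `i < j`,
  then `P(E) ≤ Σ_{j<J} P(D_j) Π_{i<j} P(B_i) + Π_{i<J} P(B_i)` (independence of events determined
  by disjoint edge sets, `bondPercolation_real_inter_of_disjoint`);
* `stub_undockedTwoArm_threeArmScale_le` — the three-arm event of one scale, `U₂ □ D₁` (undocked
  two-arm event of radii `s/2, S'` and a closed dual crossing of `{2s+1 ≤ dist ≤ S'-8}`), has
  probability `≤ C ((s/2)/S')^θ ((2s+2)/(S'-9))^α` given the undocked two-arm bound with exponent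
  `θ` and the RSW dual-crossing bound with exponent `α` (Reimer's inequality, both events local).

References: H. Kesten, Comm. Math. Phys. 109 (1987), proof of Lemma 4 [KestenScalingCMP1987];
D. Reimer, Combin. Probab. Comput. 9 (2000) [ReimerCPC2000]; G. Grimmett, *Percolation* (1999),
§2.2–2.3 [GrimmettPercolation1999].
-/

noncomputable section

open Set Metric Complex MeasureTheory
open Literature.Probability.Percolation Literature.Probability.LatticeModels

namespace Summit.CriticalPhenomena.CardyFormulaZ2.Cruxes.LagHandOff.HittingTournament

/-! ### The abstract first-docking-scale bound -/

/-- Finite intersections of events determined by sets are determined by the union. [folklore] -/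
theorem determinedBy_biInter_range {B : ℕ → Set (BondConfig (Site 2))} {FB : ℕ → Set (Sym2 (Site 2))} {J : ℕ}
    (h : ∀ i < J, DeterminedBy (B i) (FB i)) (j : ℕ) (hj : j ≤ J) :
    DeterminedBy (⋂ i ∈ Finset.range j, B i) (⋃ i ∈ Finset.range j, FB i) := by
  rw [determinedBy_iff]
  intro ω ω' hωω'
  simp only [mem_iInter, Finset.mem_range]
  refine forall_congr' fun i => forall_congr' fun hi => ?_
  have hi' : i < J := lt_of_lt_of_le hi hj
  refine (determinedBy_iff _ _).1 (h i hi') ω ω' (Z2HalfPlane.inter_eq_of_subset hωω' ?_)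
  exact subset_biUnion_of_mem (u := fun i => FB i) (Finset.mem_range.2 hi)

/-- **First-docking-scale union bound with independent scales** (bond percolation on `ℤ²` at
`1/2`): if almost every `ω ∈ E` lies, for every `j < J`, in `D_j ∪ B_j`, the `B_j` are determined
by pairwise disjoint sets `FB_j` of edges, and `D_j` by a set `FD_j` disjoint from `FB_i`, `i < j`,
then `P(E) ≤ Σ_{j<J} P(D_j) Π_{i<j} P(B_i) + Π_{i<J} P(B_i)`. [cite: KestenScalingCMP1987, proof of Lemma 4] -/
theorem real_le_sum_firstFail {J : ℕ} {E : Set (BondConfig (Site 2))} {D B : ℕ → Set (BondConfig (Site 2))}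
    {FD FB : ℕ → Set (Sym2 (Site 2))}
    (hE : ∀ᵐ ω ∂(bondPercolation (zdGraph 2) half), ω ∈ E → ∀ j < J, ω ∈ D j ∨ ω ∈ B j)
    (hdetD : ∀ j < J, DeterminedBy (D j) (FD j)) (hdetB : ∀ j < J, DeterminedBy (B j) (FB j))
    (hmD : ∀ j < J, MeasurableSet (D j)) (hmB : ∀ j < J, MeasurableSet (B j))
    (hdisjB : ∀ i j, i < j → j < J → Disjoint (FB i) (FB j))
    (hdisjD : ∀ i j, i < j → j < J → Disjoint (FB i) (FD j)) :
    (bondPercolation (zdGraph 2) half).real E ≤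
      ∑ j ∈ Finset.range J, (bondPercolation (zdGraph 2) half).real (D j) *
          ∏ i ∈ Finset.range j, (bondPercolation (zdGraph 2) half).real (B i) +
        ∏ i ∈ Finset.range J, (bondPercolation (zdGraph 2) half).real (B i) := by
  classical
  set μ := bondPercolation (zdGraph 2) half with hμ
  set F : ℕ → Set (BondConfig (Site 2)) := fun j => ⋂ i ∈ Finset.range j, B i with hF
  have hmF : ∀ j ≤ J, MeasurableSet (F j) := fun j hj =>
    MeasurableSet.biInter (Finset.range j).countable_toSet fun i hi => hmB i (lt_of_lt_of_le (Finset.mem_range.1 hi) hj)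
  -- products
  have hprod : ∀ j ≤ J, μ.real (F j) = ∏ i ∈ Finset.range j, μ.real (B i) := by
    intro j hj
    induction j with
    | zero => simp [hF]
    | succ j ih =>
      have hjJ : j < J := Nat.lt_of_succ_le hj
      have hsplit : F (j + 1) = B j ∩ F j := by
        simp only [hF, Finset.range_add_one, Finset.set_biInter_insert]
      rw [hsplit, Finset.prod_range_succ, mul_comm]
      rw [bondPercolation_real_inter_of_disjoint (zdGraph 2) half ?_ (hdetB j hjJ)
        (determinedBy_biInter_range hdetB j hjJ.le) (hmB j hjJ) (hmF j hjJ.le), ih hjJ.le]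
      rw [Set.disjoint_iUnion₂_right]
      exact fun i hi => (hdisjB i j (Finset.mem_range.1 hi) hjJ).symm
  -- independence of `D j` from `F j`
  have hind : ∀ j < J, μ.real (D j ∩ F j) = μ.real (D j) * μ.real (F j) := by
    intro j hj
    refine bondPercolation_real_inter_of_disjoint (zdGraph 2) half ?_ (hdetD j hj)
      (determinedBy_biInter_range hdetB j hj.le) (hmD j hj) (hmF j hj.le)
    rw [Set.disjoint_iUnion₂_right]
    exact fun i hi => (hdisjD i j (Finset.mem_range.1 hi) hj).symm
  -- the decomposition, almost everywhere
  have hdec : ∀ᵐ ω ∂μ, ω ∈ E → ω ∈ (⋃ j ∈ Finset.range J, (D j ∩ F j)) ∪ F J := by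
    filter_upwards [hE] with ω hω hωE
    by_cases h : ∃ j, j < J ∧ ω ∈ D j
    · left
      obtain ⟨hj₀J, hj₀D⟩ := Nat.find_spec h
      have hmin : ∀ i < Nat.find h, ω ∉ D i := fun i hi hD => Nat.find_min h hi ⟨hi.trans hj₀J, hD⟩
      simp only [mem_iUnion, Finset.mem_range, mem_inter_iff, hF, mem_iInter]
      exact ⟨Nat.find h, hj₀J, hj₀D, fun i hi => ((hω hωE) i (hi.trans hj₀J)).resolve_left (hmin i hi)⟩
    · right
      push Not at h
      simp only [hF, mem_iInter, Finset.mem_range]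
      exact fun i hi => ((hω hωE) i hi).resolve_left (h i hi)
  calc μ.real E ≤ μ.real ((⋃ j ∈ Finset.range J, (D j ∩ F j)) ∪ F J) := by
        simp only [measureReal_def]
        exact ENNReal.toReal_mono (measure_ne_top _ _) (measure_mono_ae (by filter_upwards [hdec] with ω hω h; exact hω h))
    _ ≤ μ.real (⋃ j ∈ Finset.range J, (D j ∩ F j)) + μ.real (F J) := measureReal_union_le _ _
    _ ≤ ∑ j ∈ Finset.range J, μ.real (D j ∩ F j) + μ.real (F J) := by
        gcongr; exact measureReal_biUnion_finset_le _ _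
    _ = _ := by
        rw [hprod J le_rfl]
        congr 1
        exact Finset.sum_congr rfl fun j hj => by
          rw [hind j (Finset.mem_range.1 hj), hprod j (Finset.mem_range.1 hj).le]

/-! ### The three-arm event of one scale -/

/-- **`P(U₂ □ D₁) ≤ C ((s/2)/S')^θ · ((2s+2)/(S'-9))^α` at one scale**, from the undocked two-arm
bound with exponent `θ` (applied at mesh `1`, centre `x₁`, radii `s/2, S'`), the RSW bound for
closed dual crossings of the annulus `A(x₁; 2s+2, S'-9)`, and Reimer's inequality (both events are
local, `…UndockedLocality`). [cite: ReimerCPC2000, Thm. 1.1 (van den Berg–Kesten conjecture)] -/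
theorem stub_undockedTwoArm_threeArmScale_le : ∀ {θ C cb K : ℝ},
    (∀ (x : ℂ) (δ r R : ℝ), 0 < δ → cb * δ ≤ r → K * r ≤ R → ∀ S : Set (Site 2),
      S = {v | r ≤ dist (meshPoint δ v) x ∧ dist (meshPoint δ v) x ≤ R ∧ x.im ≤ (meshPoint δ v).im} →
      (bondPercolation (zdGraph 2) half).real {ω | ∃ v w f g : Site 2,
        dist (meshPoint δ v) x ≤ 2 * r ∧ dist (meshPoint δ f) x ≤ 2 * r ∧
        R / 2 ≤ dist (meshPoint δ w) x ∧ R / 2 ≤ dist (meshPoint δ g) x ∧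
        ω ∈ openConnIn S v w ∧ dualConfig ω ∈ openConnIn S f g} ≤ C * (r / R) ^ θ) →
    ∀ {α ca : ℝ}, (∀ (x : ℂ) (δ r R : ℝ), 0 < δ → ca * δ ≤ r → 2 * r ≤ R →
      (bondPercolation (zdGraph 2) half).real (annulusDualCrossing x δ r R) ≤ (r / R) ^ α) →
    ∀ (x₁ : ℂ) {s S' : ℝ}, cb ≤ s / 2 → K * (s / 2) ≤ S' → ca ≤ 2 * s + 2 → 2 * (2 * s + 2) ≤ S' - 9 →
    ∀ (S₂ T : Set (Site 2)),
    S₂ = {v : Site 2 | s / 2 ≤ dist (meshPoint 1 v) x₁ ∧ dist (meshPoint 1 v) x₁ ≤ S' ∧ x₁.im ≤ (meshPoint 1 v).im} →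
    T = {v : Site 2 | 2 * s + 1 ≤ dist (meshPoint 1 v) x₁ ∧ dist (meshPoint 1 v) x₁ ≤ S' - 8} →
    (bondPercolation (zdGraph 2) half).real
      ({ω : BondConfig (Site 2) | ∃ v w f g : Site 2,
          dist (meshPoint 1 v) x₁ ≤ 2 * (s / 2) ∧ dist (meshPoint 1 f) x₁ ≤ 2 * (s / 2) ∧
          S' / 2 ≤ dist (meshPoint 1 w) x₁ ∧ S' / 2 ≤ dist (meshPoint 1 g) x₁ ∧
          ω ∈ openConnIn S₂ v w ∧ dualConfig ω ∈ openConnIn S₂ f g} □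
        {ω : BondConfig (Site 2) | ∃ f g : Site 2, dist (meshPoint 1 f) x₁ ≤ 2 * s + 2 ∧
          S' - 9 ≤ dist (meshPoint 1 g) x₁ ∧ dualConfig ω ∈ openConnIn T f g}) ≤
      C * ((s / 2) / S') ^ θ * ((2 * s + 2) / (S' - 9)) ^ α := by
  intro θ C cb K hX α ca hRSW x₁ s S' hcb hK hca hsS S₂ T hS₂ hT
  set μ := bondPercolation (zdGraph 2) half with hμ
  set U : Set (BondConfig (Site 2)) := {ω | ∃ v w f g : Site 2,
      dist (meshPoint 1 v) x₁ ≤ 2 * (s / 2) ∧ dist (meshPoint 1 f) x₁ ≤ 2 * (s / 2) ∧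
      S' / 2 ≤ dist (meshPoint 1 w) x₁ ∧ S' / 2 ≤ dist (meshPoint 1 g) x₁ ∧
      ω ∈ openConnIn S₂ v w ∧ dualConfig ω ∈ openConnIn S₂ f g} with hU
  set D : Set (BondConfig (Site 2)) := {ω | ∃ f g : Site 2, dist (meshPoint 1 f) x₁ ≤ 2 * s + 2 ∧
      S' - 9 ≤ dist (meshPoint 1 g) x₁ ∧ dualConfig ω ∈ openConnIn T f g} with hD
  -- locality
  have hS₂sub : S₂ ⊆ {v : Site 2 | s / 2 ≤ dist (meshPoint 1 v) x₁ ∧ dist (meshPoint 1 v) x₁ ≤ S'} := fun v hv => by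
    rw [hS₂] at hv; exact ⟨hv.1, hv.2.1⟩
  have hTsub : T ⊆ {v : Site 2 | 2 * s + 1 ≤ dist (meshPoint 1 v) x₁ ∧ dist (meshPoint 1 v) x₁ ≤ S' - 8} := fun v hv => by
    rw [hT] at hv; exact hv
  have hUloc : IsLocalEvent U := isLocalEvent_of_determinedBy_edgeAnnulus
    (stub_undockedTwoArm_determinedBy_twoArm x₁ (s / 2) S' S₂ hS₂sub _ _ _ _)
  have hDloc : IsLocalEvent D := isLocalEvent_of_determinedBy_edgeAnnulus (determinedBy_dualArm x₁ _ _ T hTsub _ _)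
  -- the two bounds
  have hUle : μ.real U ≤ C * ((s / 2) / S') ^ θ :=
    hX x₁ 1 (s / 2) S' one_pos (by linarith) hK S₂ (by rw [hS₂])
  have hDsub : D ⊆ annulusDualCrossing x₁ 1 (2 * s + 2) (S' - 9) := by
    rintro ω ⟨f, g, hf, hg, hconn⟩
    show dualConfig ω ∈ annulusOpenCrossing x₁ 1 (2 * s + 2) (S' - 9)
    rw [mem_annulusOpenCrossing_iff]
    refine ⟨f, hf, g, hg, openConnIn_mono (fun v hv => ?_) f g hconn⟩
    have := (hTsub hv).2
    show dist (meshPoint 1 v) x₁ ≤ S' - 9 + 2 * 1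
    linarith
  have hDle : μ.real D ≤ ((2 * s + 2) / (S' - 9)) ^ α :=
    (measureReal_mono hDsub (measure_ne_top _ _)).trans (hRSW x₁ 1 _ _ one_pos (by linarith) hsS)
  calc μ.real (U □ D) ≤ μ.real U * μ.real D := reimer_holds (zdGraph 2) half hUloc hDloc
    _ ≤ C * ((s / 2) / S') ^ θ * ((2 * s + 2) / (S' - 9)) ^ α :=
        mul_le_mul hUle hDle measureReal_nonneg (le_trans measureReal_nonneg hUle)

end Summit.CriticalPhenomena.CardyFormulaZ2.Cruxes.LagHandOff.HittingTournament
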